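import Literature.AlgebraicGeometry.Frobenioids.PadicKummerActions
import Literature.AlgebraicGeometry.Frobenioids.KummerInflationOne
import Literature.NumberTheory.GaloisRepresentations.ContinuousH2
import HarnessLib

/-!
# Frobenioids II, §2 (Def. 2.2, Rmk. 2.2.1, Thm. 2.4 (i), Rmk. 2.4.1): five interface rows of
# `PadicKummerSetting.lean` / `PadicKummerActions.lean` are SCHEMAS — universal closures refuted

Proof-only companion (abc-iut cell, block F fact-proving wave, seat abc-iut-f-048 gen 2; FACT-LIST
rows F-1196 `PadicKummer.Def22Context.GaloisSurjective`, F-1198 `PadicKummer.SaturatedInvariantsAdmitRoots`,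
F-0728 `PadicKummer.ExistsSaturatedPullback`, F-1194 `PadicKummer.Thm24iActionCompat`,
F-1193 `PadicKummer.Rmk241Indeterminacy`; all `kernel_closedness = parametrised`) to abc-iut-L1-t7's
`PadicKummerSetting.lean` and abc-iut-L1-d4's `PadicKummerActions.lean`.

S. Mochizuki, *The geometry of Frobenioids II*, Kyushu J. Math. **62** (2008) 401–460, §2
[cite: MochizukiFrdII2008, Def 2.2 (i) p.17]:
* Def. 2.2 (i) p. 17: "the functor `C → E` induces a natural inclusion `G_A ↪ Aut_E(A_E)` [which is
  an isomorphism if, for instance, `A_D` is Galois …]" — row F-1196;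
* Rmk. 2.2.1 p. 18: "there exists a pull-back morphism `A″ → A′` in `C` such that `A″` is
  `(N, H)`-saturated" — row F-0728 — and "any element `f ∈ O^□(A)^H` admits an `N`-th root
  `g ∈ O^□(A)`" — row F-1198;
* Thm. 2.4 (i) p. 20, final clause: the induced isomorphisms are compatible "with the various natural
  actions of `(G₁)_{A₁}/(H₁)_{A₁}`, `(G₂)_{A₂}/(H₂)_{A₂}`" — row F-1194;
* Rmk. 2.4.1 p. 22: "one obtains a profinite version of Theorem 2.4, (i), so long as one allows for a
  `(Gᵢ)_{Aᵢ}/(Hᵢ)_{Aᵢ}`-indeterminacy" — row F-1193.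

In the tree each of these sentences is typed as a PREDICATE on an ARBITRARY interface datum
(`X : Def22Context` — any groups `Aut_C(A)`, `Aut_E(A_E)`, `G ⊇ H`, any cancellative monoid `O^□(A)`
with any actions; `T : Thm24Data X₁ X₂ N` — ANY comparison data, not necessarily induced by an
equivalence `Ψ`; any family `ctx` of contexts), whereas print asserts them for the data of an actual
`p`-adic Frobenioid.  Per the cell's rule for parametrised rows (plan R1/R5, 2026-08-26) this file
records, for each row, the KERNEL verdict on the universal closure — it is FALSE, at an explicit
junk datum — and names the PROVED instance forms at the intended binding (cited, not restated):

| row | universal closure | refuted by (this file) | instance form PROVED in tree (by name) |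
|---|---|---|---|
| F-1196 `GaloisSurjective` | `∀ X, X.GaloisSurjective` | `not_forall_galoisSurjective` (`Aut_C(A) = 1`, `Aut_E(A_E) = G = Aut(ℤ) ≠ 1`, `A_D` "Galois") | `Def22Context.galoisSurjective_ofLocalField` (abc-iut-L1-t7), `galoisSurjective_ofGaloisQuot`, `galoisSurjective_ofChart` (abc-iut-w5-d248) |
| F-1198 `SaturatedInvariantsAdmitRoots` | `∀ X N, SaturatedInvariantsAdmitRoots X N` | `not_forall_saturatedInvariantsAdmitRoots` (`O = ℤ/2ℤ`, `H = 1`: `(2, H)`-saturated, yet `1 ∈ ℤ/2ℤ` has no square root) | `Def22Context.saturatedInvariantsAdmitRoots_ofLocalField` (+ `_tri`, `_units`, `_box`; abc-iut-L1-t7, [FrdII] Rmk. 2.2.1 via Kummer theory of `L^H`) |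
| F-0728 `ExistsSaturatedPullback` | `∀ Obj OpenNormal R ctx, ExistsSaturatedPullback Obj OpenNormal R ctx` | `not_forall_existsSaturatedPullback` (a context family with `A_D` never Galois) | `existsSaturatedPullback_ofLocalField` (abc-iut-L1-t7, p411862) |
| F-1194 `Thm24iActionCompat` | `∀ X₁ X₂ N T, Thm24iActionCompat X₁ X₂ N T` | `not_forall_thm24iActionCompat` (`O = ℤ × ℤ`, `G = Aut(O)`, data `T` with `isoO =` swap, not `Aut(O)`-equivariant) | `Def22Context.Iso.thm24iActionCompat` (abc-iut-L1-d4: for the data `e.thm24Data N` INDUCED by an isomorphism of contexts) |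
| F-1193 `Rmk241Indeterminacy` | `∀ X₁ X₂ N N' T T', Rmk241Indeterminacy X₁ X₂ T T'` | `not_forall_rmk241Indeterminacy` (`O = ℤ`, `G = 1` acting trivially; `T'` = `T` twisted by inversion) | `Def22Context.Iso.rmk241Indeterminacy` (abc-iut-L1-d4: for data induced by isomorphisms of contexts at two levels) |

On the way, two folklore vanishing statements for the continuous cohomology of the TRIVIAL group
(`subsingleton_continuousCohomology_one_of_subsingleton_group`, `…_two_…`) and the resulting
saturation criterion `Def22Context.isNHSaturated_of_subsingleton_H` (a context with `H = 1` is
`(N, H)`-saturated as soon as `μ_N(A) ≅ ℤ/Nℤ` and `A_D` is Galois: condition (c) of Def. 2.2 (ii) is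
then automatic, `Hⁿ(H, −) = 0` for `n = 1, 2`).

This file declares theorems only (no definition, no instance, no named fact); the junk data are
built inside the proofs.  Nothing here concerns [IUTchIII]; no side is taken on Cor. 3.12; no
statement of [FrdII] is asserted false — a predicate on interface data has instances on both sides,
and the positive instances at the `p`-adic binding are the cited theorems.
-/

namespace Literature.AlgebraicGeometry.Frobenioids

open CategoryTheory Literature.NumberTheory.GaloisRepresentations

namespace Kummer

/-! ### Continuous cohomology of the trivial group in degrees `1` and `2` -/

section TrivialGroup

variable {Γ : Type} [Group Γ] [TopologicalSpace Γ] [IsTopologicalGroup Γ] [Subsingleton Γ]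

/-- `H¹_cont(1, X) = 0`: a continuous crossed homomorphism of the one-element group vanishes
(`φ(1) = 0`), so all degree-one classes coincide. [cite: SerreGaloisCohomology1997, I §2.2] -/
theorem subsingleton_continuousCohomology_one_of_subsingleton_group (X : TopRep.{0} ℤ Γ) :
    Subsingleton (continuousCohomology 1 X) := by
  refine ⟨fun a b => ?_⟩
  obtain ⟨φ, rfl⟩ := oneCocycleClass_surjective X a
  obtain ⟨ψ, rfl⟩ := oneCocycleClass_surjective X b
  have hφψ : φ = ψ := Subtype.ext (ContinuousMap.ext fun g => by
    rw [Subsingleton.elim g 1]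
    exact (contOneCocycles.apply_one φ).trans (contOneCocycles.apply_one ψ).symm)
  rw [hφψ]

/-- `H²_cont(1, X) = 0`: a continuous inhomogeneous `2`-cocycle `f` of the one-element group is the
coboundary of the constant `1`-cochain with value `f(1, 1)`. [cite: SerreGaloisCohomology1997, I §2.3] -/
theorem subsingleton_continuousCohomology_two_of_subsingleton_group [LocallyCompactSpace Γ]
    (X : TopRep.{0} ℤ Γ) : Subsingleton (continuousCohomology 2 X) := by
  have h0 : ∀ a : continuousCohomology 2 X, a = 0 := fun a => by
    obtain ⟨f, rfl⟩ := twoCocycleClass_surjective X a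
    rw [twoCocycleClass_eq_zero_iff]
    refine ⟨ContinuousMap.const Γ ((f : C(Γ × Γ, X)) (1, 1)), fun σ τ => ?_⟩
    obtain rfl : σ = 1 := Subsingleton.elim _ _
    obtain rfl : τ = 1 := Subsingleton.elim _ _
    simp only [ContinuousMap.const_apply, mul_one, _root_.map_one X.ρ]
    change (f : C(Γ × Γ, X)) (1, 1) =
      (f : C(Γ × Γ, X)) (1, 1) - (f : C(Γ × Γ, X)) (1, 1) + (f : C(Γ × Γ, X)) (1, 1)
    abel
  exact ⟨fun a b => by rw [h0 a, h0 b]⟩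

end TrivialGroup

end Kummer

namespace PadicKummer

open Kummer

/-! ### A saturation criterion: contexts with `H = 1` -/

/-- **Definition 2.2 (ii) for a context with trivial `H`.** If `H = 1` then condition (c) is
automatic (`Hⁿ(H, −) = 0` for `n = 1, 2`, so the three maps of (c) are surjective, and the
degree-one maps are injective along the surjection `H ↠ H_A`, `isNHSaturated_iff_surjective`):
such an `A` is `(N, H)`-saturated iff it is `μ_N`-saturated and `A_D` is Galois.  (In print
`H ⊆ G ≅ G_{ℚ_p}` is open, hence never trivial; the interface allows it — this is what makes the
schema rows below refutable.) [cite: MochizukiFrdII2008, Def 2.2 (ii) p.17] -/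
theorem Def22Context.isNHSaturated_of_subsingleton_H (X : Def22Context) (N : ℕ)
    [Subsingleton X.H] [LocallyCompactSpace X.H] (hμ : IsMuSaturated N X.O) (hgal : X.isGalois) :
    IsNHSaturated X N := by
  rw [Def22Context.isNHSaturated_iff_surjective]
  haveI := subsingleton_continuousCohomology_one_of_subsingleton_group
    (TopRep.res (X.qHA : X.H →* X.HA) (muTopRep N X.O X.HA))
  haveI := subsingleton_continuousCohomology_one_of_subsingleton_group
    (TopRep.res (X.qHA : X.H →* X.HA) (trivTopRep N X.HA))
  haveI := subsingleton_continuousCohomology_two_of_subsingleton_group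
    (TopRep.res (X.qHA : X.H →* X.HA) (muTopRep N X.O X.HA))
  exact ⟨hμ, hgal, fun y => ⟨0, Subsingleton.elim _ _⟩, fun y => ⟨0, Subsingleton.elim _ _⟩,
    fun y => ⟨0, Subsingleton.elim _ _⟩⟩

/-! ### F-1196: `Def22Context.GaloisSurjective` -/

/-- **F-1196: the universal closure of `Def22Context.GaloisSurjective` is FALSE.** Def. 2.2 (i)
(FrdII p. 17) "`G_A ↪ Aut_E(A_E)` … is an isomorphism if, for instance, `A_D` is Galois [where we
recall that `C` is `Aut`-ample — cf. Theorem 1.2, (i)]" is typed as a property of an ARBITRARY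
context `X`; at the junk context with `Aut_C(A) = 1`, `Aut_E(A_E) = G = Aut(ℤ)` (two elements),
`G ↠ Aut_E(A_E)` the identity and `A_D` declared Galois, `G_A = 1` does not surject onto
`Aut_E(A_E) ∋ (x ↦ x⁻¹)`.  Instance forms PROVED at the binding: `galoisSurjective_ofLocalField`,
`galoisSurjective_ofGaloisQuot`, `galoisSurjective_ofChart` (there `Aut`-ampleness, [FrdII] Thm. 1.2
(i), is what the junk lacks). [cite: MochizukiFrdII2008, Def 2.2 (i) p.17] -/
theorem not_forall_galoisSurjective : ¬ ∀ X : Def22Context, X.GaloisSurjective := by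
  intro h
  letI : TopologicalSpace (MulAut (Multiplicative ℤ)) := ⊥
  haveI : DiscreteTopology (MulAut (Multiplicative ℤ)) := ⟨rfl⟩
  letI : MulDistribMulAction PUnit.{1} (Multiplicative ℤ) :=
    MulDistribMulAction.compHom _ (1 : PUnit.{1} →* MulAut (Multiplicative ℤ))
  let X : Def22Context :=
    { AutC := PUnit.{1}
      O := Multiplicative ℤ
      AutE := MulAut (Multiplicative ℤ)
      res := 1
      res_smul := fun _ _ => rfl
      G := MulAut (Multiplicative ℤ)
      H := ⊥
      isOpen_H := isOpen_discrete _
      isGalois := True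
      outer := MonoidHom.id _
      outer_surjective := fun _ => Function.surjective_id
      isOpen_ker_outer := isOpen_discrete _ }
  have hs : Function.Surjective X.gaToAutE := h X trivial
  obtain ⟨q, hq⟩ := hs (MulEquiv.inv (Multiplicative ℤ))
  induction q using QuotientGroup.induction_on with
  | H α =>
    have hq' : (MulEquiv.inv (Multiplicative ℤ) : MulAut (Multiplicative ℤ)) = 1 := by
      rw [← hq]
      exact QuotientGroup.kerLift_mk _ α
    have h1 : (Multiplicative.ofAdd (1 : ℤ))⁻¹ = Multiplicative.ofAdd (1 : ℤ) := by
      have := MulEquiv.congr_fun hq' (Multiplicative.ofAdd (1 : ℤ))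
      rwa [MulEquiv.inv_apply, MulAut.one_apply] at this
    rw [← ofAdd_neg] at h1
    exact absurd (Multiplicative.ofAdd.injective h1) (by decide)

/-! ### F-1198: `SaturatedInvariantsAdmitRoots` -/

/-- **F-1198: the universal closure of `SaturatedInvariantsAdmitRoots` is FALSE.** Rmk. 2.2.1 (FrdII
p. 18) "any element `f ∈ O^□(A)^H` admits an `N`-th root `g ∈ O^□(A)` — i.e., `g^N = f`" is deduced in
print from Kummer theory of the field `L^H`; typed as `IsNHSaturated X N → InvariantsAdmitRoots …`
for an ARBITRARY context it fails: at the junk context with `O^□(A) := ℤ/2ℤ` (written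
multiplicatively; `μ₂(A) = O^□(A) ≅ ℤ/2ℤ`), `G = Aut_E(A_E) = Aut_C(A) := Aut(O)` acting tautologically,
`H := 1` and `A_D` declared Galois, the object is `(2, H)`-saturated
(`isNHSaturated_of_subsingleton_H`) but the `H_A`-invariant element `1 ∈ ℤ/2ℤ` is not a square.
Instance forms PROVED at the binding: `Def22Context.saturatedInvariantsAdmitRoots_ofLocalField`
(and `_tri`, `_units`, `_box`). [cite: MochizukiFrdII2008, Rmk 2.2.1 p.18] -/
theorem not_forall_saturatedInvariantsAdmitRoots :
    ¬ ∀ (X : Def22Context) (N : ℕ), SaturatedInvariantsAdmitRoots X N := by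
  intro h
  letI : TopologicalSpace (MulAut (Multiplicative (ZMod 2))) := ⊥
  haveI : DiscreteTopology (MulAut (Multiplicative (ZMod 2))) := ⟨rfl⟩
  let X : Def22Context :=
    { AutC := MulAut (Multiplicative (ZMod 2))
      O := Multiplicative (ZMod 2)
      AutE := MulAut (Multiplicative (ZMod 2))
      res := MonoidHom.id _
      res_smul := fun _ _ => rfl
      G := MulAut (Multiplicative (ZMod 2))
      H := ⊥
      isOpen_H := isOpen_discrete _
      isGalois := True
      outer := MonoidHom.id _
      outer_surjective := fun _ => Function.surjective_id
      isOpen_ker_outer := isOpen_discrete _ }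
  -- `μ₂(A) = O^×(A) = O^□(A) ≅ ℤ/2ℤ`
  have htop : rootsOfUnity 2 (Multiplicative (ZMod 2)) = ⊤ := by
    refine eq_top_iff.2 fun u _ => (mem_rootsOfUnity 2 u).2 (Units.ext ?_)
    have h2 : ∀ x : Multiplicative (ZMod 2), x ^ 2 = 1 := by decide
    rw [Units.val_pow_eq_pow_val, Units.val_one]
    exact h2 _
  have hμ : IsMuSaturated 2 X.O :=
    ⟨⟨(MulEquiv.subgroupCongr htop).trans (Subgroup.topEquiv.trans toUnits.symm)⟩⟩
  have hsat : IsNHSaturated X 2 := X.isNHSaturated_of_subsingleton_H 2 hμ trivial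
  -- every element is `H_A`-invariant (`H_A = 1`), but `1 ∈ ℤ/2ℤ` has no square root
  have hHA : ∀ k : X.HA, (k : MulAut (Multiplicative (ZMod 2))) = 1 := fun k => by
    obtain ⟨g, hg, hk⟩ := k.2
    have hg1 : g = 1 := Subgroup.mem_bot.mp hg
    rw [← hk, hg1, map_one]
  have hinv : ∀ k : X.HA, (k : MulAut (Multiplicative (ZMod 2))) •
      (Multiplicative.ofAdd (1 : ZMod 2) : Multiplicative (ZMod 2)) = Multiplicative.ofAdd (1 : ZMod 2) :=
    fun k => by rw [hHA k]; exact one_smul _ _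
  obtain ⟨g, hg⟩ := h X 2 hsat (Multiplicative.ofAdd (1 : ZMod 2)) hinv
  have h2 : ∀ x : Multiplicative (ZMod 2), x ^ 2 ≠ Multiplicative.ofAdd (1 : ZMod 2) := by decide
  exact h2 g hg

/-! ### F-0728: `ExistsSaturatedPullback` -/

/-- **F-0728: the universal closure of `ExistsSaturatedPullback` is FALSE.** Rmk. 2.2.1 (FrdII p. 18)
"given an `A′ ∈ Ob(C)`, … there exists a pull-back morphism `A″ → A′` in `C` such that `A″` is
`(N, H)`-saturated" is typed over ARBITRARY parameters `Obj`, `OpenNormal`, a relation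
`HasPullbackMorphismTo` and a family of contexts `ctx`; for the constant family with value a context
whose `A_D` is NOT Galois no value is ever `(N, H)`-saturated (condition (b) of Def. 2.2 (ii)), so no
saturated pull-back exists.  Instance form PROVED at the binding (finiteness of `H¹`, `H²` [NSW
7.2.6]): `existsSaturatedPullback_ofLocalField` (abc-iut-L1-t7). [cite: MochizukiFrdII2008, Rmk 2.2.1 p.18] -/
theorem not_forall_existsSaturatedPullback :
    ¬ ∀ (Obj OpenNormal : Type) (HasPullbackMorphismTo : Obj → Obj → Prop)
        (ctx : Obj → OpenNormal → Def22Context),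
        ExistsSaturatedPullback Obj OpenNormal HasPullbackMorphismTo ctx := by
  intro h
  let X : Def22Context :=
    { AutC := PUnit.{1}
      O := PUnit.{1}
      AutE := PUnit.{1}
      res := MonoidHom.id _
      res_smul := fun _ _ => rfl
      G := PUnit.{1}
      H := ⊤
      isOpen_H := isOpen_discrete _
      isGalois := False
      outer := MonoidHom.id _
      outer_surjective := fun hf => hf.elim
      isOpen_ker_outer := isOpen_discrete _ }
  obtain ⟨_, -, hsat⟩ :=
    h PUnit.{1} PUnit.{1} (fun _ _ => True) (fun _ _ => X) PUnit.unit 1 PUnit.unit one_pos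
  exact hsat.galois

/-! ### F-1194: `Thm24iActionCompat` -/

/-- **F-1194: the universal closure of `Thm24iActionCompat` is FALSE.** The final clause of Thm. 2.4
(i) (FrdII p. 20), compatibility "with the various natural actions of `(G₁)_{A₁}/(H₁)_{A₁}`,
`(G₂)_{A₂}/(H₂)_{A₂}`", is typed as a property of ARBITRARY comparison data `T : Thm24Data X₁ X₂ N`
(print: the data INDUCED by an equivalence `Ψ`).  At the junk context with
`O^□(A) := ℤ × ℤ`, `G = Aut_E(A_E) = Aut_C(A) := Aut(O)` acting tautologically and `H := 1`
(so that `H_A = 1` imposes no equivariance), the data `T` with all components the identity except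
`isoO :=` the coordinate swap violate the first clause (equivariance of `isoO` along `G`): swap does
not commute with inversion of the first coordinate.  Instance form PROVED: abc-iut-L1-d4's
`Def22Context.Iso.thm24iActionCompat` (for `T = e.thm24Data N`, `e` an isomorphism of contexts).
[cite: MochizukiFrdII2008, Thm 2.4 (i) p.20] -/
theorem not_forall_thm24iActionCompat :
    ¬ ∀ (X₁ X₂ : Def22Context) (N : ℕ) (T : Thm24Data X₁ X₂ N), Thm24iActionCompat X₁ X₂ N T := by
  intro h
  letI : TopologicalSpace (MulAut (Multiplicative ℤ × Multiplicative ℤ)) := ⊥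
  haveI : DiscreteTopology (MulAut (Multiplicative ℤ × Multiplicative ℤ)) := ⟨rfl⟩
  let X : Def22Context :=
    { AutC := MulAut (Multiplicative ℤ × Multiplicative ℤ)
      O := Multiplicative ℤ × Multiplicative ℤ
      AutE := MulAut (Multiplicative ℤ × Multiplicative ℤ)
      res := MonoidHom.id _
      res_smul := fun _ _ => rfl
      G := MulAut (Multiplicative ℤ × Multiplicative ℤ)
      H := ⊥
      isOpen_H := isOpen_discrete _
      isGalois := True
      outer := MonoidHom.id _
      outer_surjective := fun _ => Function.surjective_id
      isOpen_ker_outer := isOpen_discrete _ }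
  have hHA : ∀ k : X.HA, (k : MulAut (Multiplicative ℤ × Multiplicative ℤ)) = 1 := fun k => by
    obtain ⟨g, hg, hk⟩ := k.2
    have hg1 : g = 1 := Subgroup.mem_bot.mp hg
    rw [← hk, hg1, map_one]
  let T : Thm24Data X X 1 :=
    { isoG := ContinuousMulEquiv.refl _
      mapsH := Subgroup.map_bot _
      isoO := MulEquiv.prodComm
      isoHA := MulEquiv.refl _
      isoGA := MulEquiv.refl _
      equivariant := fun k x => by
        change MulEquiv.prodComm ((k : MulAut (Multiplicative ℤ × Multiplicative ℤ)) • x) =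
          (k : MulAut (Multiplicative ℤ × Multiplicative ℤ)) • MulEquiv.prodComm x
        rw [hHA k, one_smul, one_smul]
      isoH1 := AddEquiv.refl _
      isoFN := AddEquiv.refl _ }
  -- inversion of the first coordinate, an element of `G = Aut(ℤ × ℤ)`
  obtain ⟨h1, -, -, -⟩ :=
    h X X 1 T (MulEquiv.prodCongr (MulEquiv.inv (Multiplicative ℤ)) (MulEquiv.refl (Multiplicative ℤ)))
  have key := congr_arg Prod.snd (h1 (Multiplicative.ofAdd (1 : ℤ), 1))
  change ((MulEquiv.prodCongr (MulEquiv.inv (Multiplicative ℤ)) (MulEquiv.refl (Multiplicative ℤ)))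
      (Multiplicative.ofAdd (1 : ℤ), 1)).1 =
    ((MulEquiv.prodCongr (MulEquiv.inv (Multiplicative ℤ)) (MulEquiv.refl (Multiplicative ℤ)))
      (1, Multiplicative.ofAdd (1 : ℤ))).2 at key
  change (Multiplicative.ofAdd (1 : ℤ))⁻¹ = Multiplicative.ofAdd (1 : ℤ) at key
  rw [← ofAdd_neg] at key
  exact absurd (Multiplicative.ofAdd.injective key) (by decide)

/-! ### F-1193: `Rmk241Indeterminacy` -/

/-- **F-1193: the universal closure of `Rmk241Indeterminacy` is FALSE.** Rmk. 2.4.1 (FrdII p. 22):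
the profinite version of Thm. 2.4 (i) holds "so long as one allows for a
`(Gᵢ)_{Aᵢ}/(Hᵢ)_{Aᵢ}`-indeterminacy"; the tree's finite-level rendering says that two comparison data
`T`, `T'` (levels `N`, `N'`) differ by the action of an element of `G₂` — typed for ARBITRARY data.
At the junk context with `O^□(A) := ℤ`, `Aut_E(A_E) = Aut_C(A) := Aut(ℤ)` acting tautologically,
`G := 1` (so `H_A = 1` and `G` acts trivially), the identity data `T` and their twist `T'` by
inversion of `O` (`isoO := (x ↦ x⁻¹)`) are both comparison data, but no element of `G = 1` moves
`1 ∈ ℤ` to `−1`.  Instance form PROVED: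
abc-iut-L1-d4's `Def22Context.Iso.rmk241Indeterminacy` (data induced by isomorphisms of contexts).
[cite: MochizukiFrdII2008, Rmk 2.4.1 p.22] -/
theorem not_forall_rmk241Indeterminacy :
    ¬ ∀ (X₁ X₂ : Def22Context) (N N' : ℕ) (T : Thm24Data X₁ X₂ N) (T' : Thm24Data X₁ X₂ N'),
        Rmk241Indeterminacy X₁ X₂ T T' := by
  intro h
  let X : Def22Context :=
    { AutC := MulAut (Multiplicative ℤ)
      O := Multiplicative ℤ
      AutE := MulAut (Multiplicative ℤ)
      res := MonoidHom.id _
      res_smul := fun _ _ => rfl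
      G := PUnit.{1}
      H := ⊤
      isOpen_H := isOpen_discrete _
      isGalois := False
      outer := 1
      outer_surjective := fun hf => hf.elim
      isOpen_ker_outer := isOpen_discrete _ }
  have hHA : ∀ k : X.HA, (k : MulAut (Multiplicative ℤ)) = 1 := fun k => by
    obtain ⟨g, -, hk⟩ := k.2
    rw [← hk]
    rfl
  let T : Thm24Data X X 1 :=
    { isoG := ContinuousMulEquiv.refl _
      mapsH := Subsingleton.elim _ _
      isoO := MulEquiv.refl _
      isoHA := MulEquiv.refl _
      isoGA := MulEquiv.refl _
      equivariant := fun k x => by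
        change MulEquiv.refl _ ((k : MulAut (Multiplicative ℤ)) • x) =
          (k : MulAut (Multiplicative ℤ)) • MulEquiv.refl _ x
        rw [hHA k, one_smul, one_smul]
      isoH1 := AddEquiv.refl _
      isoFN := AddEquiv.refl _ }
  let T' : Thm24Data X X 1 :=
    { isoG := ContinuousMulEquiv.refl _
      mapsH := Subsingleton.elim _ _
      isoO := MulEquiv.inv (Multiplicative ℤ)
      isoHA := MulEquiv.refl _
      isoGA := MulEquiv.refl _
      equivariant := fun k x => by
        change MulEquiv.inv _ ((k : MulAut (Multiplicative ℤ)) • x) =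
          (k : MulAut (Multiplicative ℤ)) • MulEquiv.inv _ x
        rw [hHA k, one_smul, one_smul]
      isoH1 := AddEquiv.refl _
      isoFN := AddEquiv.refl _ }
  obtain ⟨g, hg, -⟩ := h X X 1 1 T T'
  have key := hg (Multiplicative.ofAdd (1 : ℤ))
  change MulEquiv.inv (Multiplicative ℤ) (Multiplicative.ofAdd (1 : ℤ)) =
    (1 : MulAut (Multiplicative ℤ)) • MulEquiv.refl _ (Multiplicative.ofAdd (1 : ℤ)) at key
  rw [one_smul, MulEquiv.refl_apply, MulEquiv.inv_apply, ← ofAdd_neg] at key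
  exact absurd (Multiplicative.ofAdd.injective key) (by decide)

end PadicKummer

end Literature.AlgebraicGeometry.Frobenioids
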